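import Mathlib

/-!
# Sahi's Example 13: the one-variable elimination behind Theorem 1 does NOT preserve the
# increasing cone `ℐ` — the printed obstruction to proving `C_n` by induction on the ground set

CITATION HEADER.  Source: S. Sahi, *Higher correlation inequalities*, Combinatorica **28** (2)
(2008) 209–227, doi:10.1007/s00493-008-2249-5 [bib key `Sahi2008`] — read 2026-08-19 from the
author's reprint `https://sites.math.rutgers.edu/~sahi/Reprints/08highercorrelation.pdf` (corpus
`paper:url-5f6060b183b5`; journal page = 208 + file page): the setting p. 209–210 (the cone `𝒫`,
the cones `𝒫[X] ⊇ ℐ[X] ⊇ 𝒞[X]`, the product measure (2)), the warning p. 212 ("none of the usual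
inductive proofs of the FKG inequality seem to apply in this setting, and a slight natural
strengthening of the conjecture turns out to be false"), the elimination (12) p. 218, the Appendix
§3.3 p. 221 ("The key to the inductive proof of Theorem 1 is the result that
`F ∈ 𝒞(X) ⇒ F_x ∈ 𝒞(X∖{x})` for `x ∈ X`, where `F_x` is as defined in (12).  We show by an example
that this is false for `F ∈ ℐ(X)`") and **Example 13** p. 222, verbatim:

  "Let `X = {1,2}`, let `μ` be the uniform product measure so that `μ(S) = 1/4` for all `S ⊆ X`,
  and let `F ∈ R[{1,2}]` be defined by `F(∅) = 0, F({1}) = t², F({2}) = t² + t³,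
  F({1,2}) = t² + t³`.  Clearly we have `F ∈ ℐ[{1,2}]`.  However using (12) we get
  `F₂({1}) − F₂(∅) = (1−0)^{1/2}(1−t²−t³)^{1/2} − (1−t²)^{1/2}(1−t²−t³)^{1/2}`.  Computing the
  coefficient of `t⁵` in this expression we get
  `(1 − (1−t²)^{1/2})(1−t²−t³)^{1/2} ∼ (½t²)(−½t³) = −¼t⁵`.  The negative sign shows that
  `F₂ ∉ ℐ[{1}]`."

Origin: cell `prim-sahi` (bundle papers/CriticalPhenomena/sahi-implies-continuity/), unit
`prim-sahi-lit` gen 4, crux `stmt-CriticalPhenomena-4575` (one-cut engine; Sahi's `C_n` is the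
conjectural engine of the open rungs `|A| ≥ 5`, see `Summits/CriticalPhenomena/
PercolationContinuityZ3/Theorems/SahiConjecture.lean`).  Companion (the POSITIVE theorem whose
induction step this example bounds): `Literature/Combinatorics/Sahi2008/CumulationCone.lean`
(`sahi2008_thm1`/`sahi2008_thm1_aux`: Theorem 1 proved by exactly this elimination on the cone `𝒞`).

BARRIER CARD (D-0021; every line is the source's, nothing is ranked or editorialised).
* technique_class: proofs of Sahi's Conjecture 4 / Conjecture 5 (`C_n`, `E_n ≥ 0` for increasing
  positive functions) by induction on the ground set `X` through the one-variable elimination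
  `F ↦ F_x` of (12), i.e. through the implication "`F ∈ ℐ[X] ⇒ F_x ∈ ℐ[X∖{x}]`"
  [cite: Sahi2008, §3.3 (p. 221) and p. 212].
* blocks: the extension of the proof of Theorem 1 [cite: Sahi2008, Thm. 1 (p. 210), proof
  pp. 218–219] from the cumulation cone `𝒞[X]` to the increasing cone `ℐ[X]` (which would give
  Conjecture 4, hence Conjecture 5 = `C_n` for product measures, by Prop. 12)
  [cite: Sahi2008, p. 212 ("a slight natural strengthening of the conjecture turns out to be false")].
* because: for `X = {1,2}`, the uniform product measure and the `ℐ`-valued `F` above,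
  `F₂({1}) − F₂(∅)` has `t⁵`-coefficient `−1/4 < 0`, so `F₂ ∉ ℐ[{1}]`
  [cite: Sahi2008, Example 13 (p. 222)] — `elimination_not_increasing` below.
* evasions_known: (i) restrict to `𝒞[X]`, where the elimination IS closed — Theorem 1 / Theorem 2,
  all `n` [cite: Sahi2008, Thm. 1, Thm. 2; Lemmas 7, 10, 11] (tree: `sahi2008_thm1`,
  `sahi2008_thm2`); (ii) for `|X| ≤ 2` eliminate BOTH variables at once with the five-parameter
  normal form of Lemma 14 and the coefficient inequality of Lemma 16 — Proposition 15, every FKG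
  measure, every `n` [cite: Sahi2008, Lemma 14, Prop. 15, Lemma 16 (pp. 222–226)] (tree:
  `SahiTwoPointLatticeTheorem_holds`); (iii) on `[0,1]²` an induction on `n` (not on the ground
  set) with an extremal argument [cite: LiebSahi2021, Thms. 3.11–3.13] (tree:
  `LiebSahiGrid.sahiPositive_uniformGrid`); (iv) peel principal (cumulation) slots only
  [cite: Blinovsky2013, Lemma and (er9)] (tree: `sahiE_nonneg_of_isLatticeCumulation`).
* scope_caveats: the example refutes ONLY the closure of `ℐ` under the specific map (12) (one
  point `x`, exponents `1 − m_x`, `m_x`), at `|X| = 2`, `m ≡ 1/2`; it says nothing against `C_n`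
  itself, which HOLDS for `|X| ≤ 2` [cite: Sahi2008, Prop. 15], and nothing about inductions that
  eliminate several variables jointly or induct on `n`; the paper prints the computation for the
  uniform measure only.
* status: established (refereed journal; the computation is re-done below in the kernel).

WHAT IS PROVED HERE (kernel; no facts, no axioms beyond Mathlib's).  In Sahi's own ring
`R = ℝ⟦t⟧`:
* `oneSubPow c G = (1 − G)^c := Σ_k C(c,k) (−G)^k` (the binomial series, Mathlib
  `PowerSeries.binomialSeries`, substituted at `−G`, `G(0) = 0`) with the exponent laws that make
  it the power Sahi uses ("expand using the binomial theorem", p. 218), as private API lemmas: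
  `oneSubPow_natCast` (`= (1−G)^n` for `n ∈ ℕ`), `oneSubPow_add`, `constantCoeff_oneSubPow`,
  hence `oneSubPow_half_mul_self : (1−G)^{1/2} · (1−G)^{1/2} = 1 − G`.
* Sahi's cones `InP` (`𝒫`), `InI` (`ℐ[X]`) and the elimination `elim m x F = F_x` of (12), for
  any finite ground set and any parameters `m`.
* `exF` = the `F` of Example 13 (`exF_empty/one/two/pair` display its four values), `exF_inI`
  (`F ∈ ℐ[{1,2}]`), `coeff_five_elim` (the `t⁵`-coefficient of `F₂({1}) − F₂(∅)` is `−1/4`),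
  `elim_not_inI` (`F₂ ∉ ℐ[{1}]`), and the packaged negative result
  `elimination_not_increasing` (there are `X`, `x ∈ X`, `m ∈ [0,1]^X`, `F ∈ ℐ[X]` with
  `F_x ∉ ℐ[X∖{x}]`).
The coefficients of `(1−t²−t³)^{1/2}` and `(1−t²)^{1/2}` up to `t⁵` are obtained from
`S·S = 1 − t² − t³`, `S(0) = 1` (resp. `R·R = 1 − t²`) by the triangular recursion, exactly the
expansion `(½t²)(−½t³)` of the source.

Relation to the square-free form of the tree's Theorem 1 (`CumulationCone.lean` works in
`ℝ[t_i]/(t_i²)` via Sahi's specialisation `t_i = t^{k_i}`, p. 220): writing `F = t²·f + t³·g` with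
`f = 1_{S ≠ ∅}`, `g = 1_{2 ∈ S}`, the `t⁵`-coefficient above is the coefficient of the square-free
monomial `t_0 t_1` under `t_0 = t², t_1 = t³` (`t⁵ = t²·t³` is the only factorisation), so the same
`−1/4` obstructs the square-free induction of `sahi2008_thm1_aux` outside `𝒞`.
-/

noncomputable section

open PowerSeries Finset

namespace Literature.Barriers.CriticalPhenomena.SahiElimination

/-! ### Real powers `(1 - G)^c` of a power series without constant term -/

/-- `(1 − G)^c := Σ_{k ≥ 0} C(c,k) (−G)^k` for a real exponent `c` and `G ∈ tℝ⟦t⟧`: Mathlib's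
binomial series `(1 + X)^c` substituted at `X = −G` (meaningful when `G` has no constant term).
This is the power appearing in Sahi's `∏_S (1 − F(S))^{μ(S)}` and in (12), expanded "using the
binomial theorem". [cite: Sahi2008, eq. (3) (p. 210) and p. 218] -/
def oneSubPow (c : ℝ) (G : ℝ⟦X⟧) : ℝ⟦X⟧ := (PowerSeries.binomialSeries ℝ c).subst (-G)

variable {G : ℝ⟦X⟧}

/-- `−G` may be substituted when `G` has no constant term. [folklore] -/
private theorem hasSubst_neg (hG : constantCoeff G = 0) : HasSubst (-G) :=
  HasSubst.of_constantCoeff_zero' (by rw [map_neg, hG, neg_zero])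

/-- Exponent law `(1−G)^{a+b} = (1−G)^a (1−G)^b` (Vandermonde, Mathlib `binomialSeries_add`).
[folklore] -/
private theorem oneSubPow_add (hG : constantCoeff G = 0) (a b : ℝ) :
    oneSubPow (a + b) G = oneSubPow a G * oneSubPow b G := by
  unfold oneSubPow
  rw [PowerSeries.binomialSeries_add, subst_mul (hasSubst_neg hG)]

/-- For a natural exponent the binomial series gives the ordinary power `(1−G)^n`. [folklore] -/
private theorem oneSubPow_natCast (hG : constantCoeff G = 0) (n : ℕ) :
    oneSubPow (n : ℝ) G = (1 - G) ^ n := by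
  unfold oneSubPow
  rw [PowerSeries.binomialSeries_nat, ← coe_substAlgHom (hasSubst_neg hG), map_pow, map_add,
    map_one, substAlgHom_X, ← sub_eq_add_neg]

/-- `(1−G)^1 = 1 − G`. [folklore] -/
private theorem oneSubPow_one (hG : constantCoeff G = 0) : oneSubPow 1 G = 1 - G := by
  have h := oneSubPow_natCast hG 1
  rwa [Nat.cast_one, pow_one] at h

/-- `(1−G)^{1/2}` is a square root of `1 − G`. [folklore] -/
private theorem oneSubPow_half_mul_self (hG : constantCoeff G = 0) :
    oneSubPow (1 / 2) G * oneSubPow (1 / 2) G = 1 - G := by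
  rw [← oneSubPow_add hG, add_halves, oneSubPow_one hG]

/-- `(1−G)^c` has constant term `1`. [folklore] -/
private theorem constantCoeff_oneSubPow (hG : constantCoeff G = 0) (c : ℝ) :
    constantCoeff (oneSubPow c G) = 1 := by
  unfold oneSubPow
  rw [← coeff_zero_eq_constantCoeff_apply, coeff_subst' (hasSubst_neg hG),
    finsum_eq_single _ 0 (fun d hd => ?_)]
  · simp
  · rw [coeff_zero_eq_constantCoeff, map_pow, map_neg, hG, neg_zero, zero_pow hd, smul_zero]

/-- `(1−0)^c = 1` (Sahi's factor `(1 − 0)^{1/2}` in Example 13). [folklore] -/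
private theorem oneSubPow_zero_right (c : ℝ) : oneSubPow c 0 = 1 := by
  unfold oneSubPow
  rw [neg_zero]
  ext n
  rw [coeff_subst' HasSubst.zero', finsum_eq_single _ 0 (fun d hd => ?_)]
  · simp [coeff_one]
  · rw [zero_pow hd, map_zero, smul_zero]

/-! ### Coefficient bookkeeping: square roots of `1 − t² − t³` and `1 − t²` up to `t⁵` -/

/-- Cauchy product written over `range (n+1)`. [folklore] -/
private theorem coeff_mul_range (φ ψ : ℝ⟦X⟧) (n : ℕ) :
    coeff n (φ * ψ) = ∑ k ∈ range (n + 1), coeff k φ * coeff (n - k) ψ := by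
  rw [coeff_mul, Finset.Nat.sum_antidiagonal_eq_sum_range_succ_mk]

/-- The coefficients of `S = (1 − t² − t³)^{1/2}` up to `t⁵`, from `S² = 1 − t² − t³`, `S(0) = 1`:
`S = 1 − ½t² − ½t³ − ⅛t⁴ − ¼t⁵ + O(t⁶)`. [cite: Sahi2008, Example 13 (p. 222)] -/
private theorem coeffs_sqrt_cubic (S : ℝ⟦X⟧) (h0 : constantCoeff S = 1)
    (hS : S * S = 1 - ((X : ℝ⟦X⟧) ^ 2 + X ^ 3)) :
    coeff 1 S = 0 ∧ coeff 2 S = -1 / 2 ∧ coeff 3 S = -1 / 2 ∧ coeff 4 S = -1 / 8 ∧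
      coeff 5 S = -1 / 4 := by
  have e1 := congrArg (coeff 1) hS
  have e2 := congrArg (coeff 2) hS
  have e3 := congrArg (coeff 3) hS
  have e4 := congrArg (coeff 4) hS
  have e5 := congrArg (coeff 5) hS
  simp only [coeff_mul_range, Finset.sum_range_succ, Finset.sum_range_zero, map_sub, map_add,
    coeff_one, coeff_X_pow] at e1 e2 e3 e4 e5
  norm_num at e1 e2 e3 e4 e5
  rw [h0] at e1 e2 e3 e4 e5
  have s1 : coeff 1 S = 0 := by nlinarith
  rw [s1] at e2 e3 e4 e5
  have s2 : coeff 2 S = -1 / 2 := by linarith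
  rw [s2] at e3 e4 e5
  have s3 : coeff 3 S = -1 / 2 := by linarith
  rw [s3] at e4 e5
  have s4 : coeff 4 S = -1 / 8 := by linarith
  rw [s4] at e5
  have s5 : coeff 5 S = -1 / 4 := by linarith
  exact ⟨s1, s2, s3, s4, s5⟩

/-- The coefficients of `R = (1 − t²)^{1/2}` up to `t⁵`: `R = 1 − ½t² − ⅛t⁴ + O(t⁶)`.
[cite: Sahi2008, Example 13 (p. 222)] -/
private theorem coeffs_sqrt_quad (R : ℝ⟦X⟧) (h0 : constantCoeff R = 1)
    (hR : R * R = 1 - (X : ℝ⟦X⟧) ^ 2) :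
    coeff 1 R = 0 ∧ coeff 2 R = -1 / 2 ∧ coeff 3 R = 0 ∧ coeff 4 R = -1 / 8 ∧ coeff 5 R = 0 := by
  have e1 := congrArg (coeff 1) hR
  have e2 := congrArg (coeff 2) hR
  have e3 := congrArg (coeff 3) hR
  have e4 := congrArg (coeff 4) hR
  have e5 := congrArg (coeff 5) hR
  simp only [coeff_mul_range, Finset.sum_range_succ, Finset.sum_range_zero, map_sub,
    coeff_one, coeff_X_pow] at e1 e2 e3 e4 e5
  norm_num at e1 e2 e3 e4 e5
  rw [h0] at e1 e2 e3 e4 e5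
  have s1 : coeff 1 R = 0 := by nlinarith
  rw [s1] at e2 e3 e4 e5
  have s2 : coeff 2 R = -1 / 2 := by linarith
  rw [s2] at e3 e4 e5
  have s3 : coeff 3 R = 0 := by linarith
  rw [s3] at e4 e5
  have s4 : coeff 4 R = -1 / 8 := by linarith
  rw [s4] at e5
  have s5 : coeff 5 R = 0 := by linarith
  exact ⟨s1, s2, s3, s4, s5⟩

/-! ### Sahi's cones `𝒫`, `ℐ[X]` and the one-variable elimination (12) -/

/-- Sahi's cone `𝒫 := {a₁t + a₂t² + ⋯ ∈ ℝ⟦t⟧ | aᵢ ≥ 0 for all i}`: no constant term, all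
coefficients nonnegative. [cite: Sahi2008, p. 209] -/
def InP (A : ℝ⟦X⟧) : Prop := constantCoeff A = 0 ∧ ∀ n, 0 ≤ coeff n A

variable {ι : Type*} [DecidableEq ι]

/-- Sahi's cone of increasing positive functions on `2^U`:
`ℐ[U] := {F ∈ 𝒫[U] | F(T) − F(S) ∈ 𝒫 for all S ⊆ T ⊆ U}` (`𝒫[U]` = the `𝒫`-valued functions
on `2^U`).  Functions are taken on all finite subsets of the ground type and only their values on
`2^U` are constrained. [cite: Sahi2008, p. 209–210] -/
def InI (U : Finset ι) (F : Finset ι → ℝ⟦X⟧) : Prop :=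
  (∀ S, S ⊆ U → InP (F S)) ∧ ∀ S T, S ⊆ T → T ⊆ U → InP (F T - F S)

/-- Sahi's one-variable elimination (12): for parameters `m_y ∈ [0,1]` of the product measure (2)
and a point `x`, `F_x ∈ R[U ∖ {x}]` is defined by
`1 − F_x(T) = [1 − ρ⁻ₓF(T)]^{1−mₓ} · [1 − ρ⁺ₓF(T)]^{mₓ}`, `ρ⁻ₓF(T) = F(T)`,
`ρ⁺ₓF(T) = F(T ∪ {x})` — the step `∏_{S⊆U}(1−F(S))^{μ(S)} = ∏_{T⊆U∖x}(1−F_x(T))^{ν(T)}` of the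
proof of Theorem 1. [cite: Sahi2008, eq. (12) (p. 218); ρ± p. 215] -/
def elim (m : ι → ℝ) (x : ι) (F : Finset ι → ℝ⟦X⟧) (T : Finset ι) : ℝ⟦X⟧ :=
  1 - oneSubPow (1 - m x) (F T) * oneSubPow (m x) (F (insert x T))

/-! ### Example 13 -/

/-- The `t²`-coefficient of Sahi's `F`: `0` at `∅`, `1` otherwise. [cite: Sahi2008, Example 13 (p. 222)] -/
def exA (S : Finset ℕ) : ℝ := if S = ∅ then 0 else 1

/-- The `t³`-coefficient of Sahi's `F`: `1` iff `2 ∈ S`. [cite: Sahi2008, Example 13 (p. 222)] -/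
def exB (S : Finset ℕ) : ℝ := if 2 ∈ S then 1 else 0

/-- Sahi's `F ∈ R[{1,2}]` of Example 13: `F(∅) = 0`, `F({1}) = t²`, `F({2}) = t² + t³`,
`F({1,2}) = t² + t³` (see `exF_empty`, `exF_one`, `exF_two`, `exF_pair`).
[cite: Sahi2008, Example 13 (p. 222)] -/
def exF (S : Finset ℕ) : ℝ⟦X⟧ := C (exA S) * X ^ 2 + C (exB S) * X ^ 3

/-- `F(∅) = 0`. [cite: Sahi2008, Example 13 (p. 222)] -/
theorem exF_empty : exF ∅ = 0 := by simp [exF, exA, exB]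

/-- `F({1}) = t²`. [cite: Sahi2008, Example 13 (p. 222)] -/
theorem exF_one : exF {1} = X ^ 2 := by simp [exF, exA, exB]

/-- `F({2}) = t² + t³`. [cite: Sahi2008, Example 13 (p. 222)] -/
theorem exF_two : exF {2} = X ^ 2 + X ^ 3 := by simp [exF, exA, exB]

/-- `F({1,2}) = t² + t³`. [cite: Sahi2008, Example 13 (p. 222)] -/
theorem exF_pair : exF {1, 2} = X ^ 2 + X ^ 3 := by simp [exF, exA, exB]

/-- `p t² + q t³ ∈ 𝒫` for `p, q ≥ 0`. [folklore] -/
private theorem inP_C_mul_add {p q : ℝ} (hp : 0 ≤ p) (hq : 0 ≤ q) :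
    InP (C p * X ^ 2 + C q * X ^ 3) := by
  refine ⟨by simp, fun n => ?_⟩
  have h1 : (0 : ℝ) ≤ (if n = 2 then 1 else 0) := by split_ifs <;> norm_num
  have h2 : (0 : ℝ) ≤ (if n = 3 then 1 else 0) := by split_ifs <;> norm_num
  rw [map_add, coeff_C_mul, coeff_C_mul, coeff_X_pow, coeff_X_pow]
  exact add_nonneg (mul_nonneg hp h1) (mul_nonneg hq h2)

/-- The `t²`-coefficient of `F` is increasing in `S`. [folklore] -/
private theorem exA_mono {S T : Finset ℕ} (h : S ⊆ T) : exA S ≤ exA T := by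
  unfold exA
  split_ifs with hS hT hT
  · exact le_rfl
  · exact zero_le_one
  · exact absurd (Finset.subset_empty.mp (hT ▸ h)) hS
  · exact le_rfl

/-- The `t³`-coefficient of `F` is increasing in `S`. [folklore] -/
private theorem exB_mono {S T : Finset ℕ} (h : S ⊆ T) : exB S ≤ exB T := by
  unfold exB
  split_ifs with hS hT hT
  · exact le_rfl
  · exact absurd (h hS) hT
  · exact zero_le_one
  · exact le_rfl

/-- "Clearly we have `F ∈ ℐ[{1,2}]`." [cite: Sahi2008, Example 13 (p. 222)] -/
theorem exF_inI : InI ({1, 2} : Finset ℕ) exF := by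
  refine ⟨fun S _ => ?_, fun S T hST _ => ?_⟩
  · unfold exF
    refine inP_C_mul_add ?_ ?_
    · unfold exA; split_ifs <;> norm_num
    · unfold exB; split_ifs <;> norm_num
  · have : exF T - exF S = C (exA T - exA S) * X ^ 2 + C (exB T - exB S) * X ^ 3 := by
      simp only [exF, map_sub]; ring
    rw [this]
    exact inP_C_mul_add (sub_nonneg.mpr (exA_mono hST)) (sub_nonneg.mpr (exB_mono hST))

/-- The parameters of the uniform product measure on `2^{{1,2}}`: `m_x = 1/2`, `μ(S) = 1/4`.
[cite: Sahi2008, eq. (2) (p. 210) and Example 13 (p. 222)] -/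
def half : ℕ → ℝ := fun _ => 1 / 2

/-- `F₂({1}) − F₂(∅) = (1−0)^{1/2}(1−t²−t³)^{1/2} − (1−t²)^{1/2}(1−t²−t³)^{1/2}`.
[cite: Sahi2008, Example 13 (p. 222)] -/
theorem elim_one_sub_elim_empty :
    elim half 2 exF {1} - elim half 2 exF ∅ =
      oneSubPow (1 / 2) (X ^ 2 + X ^ 3) -
        oneSubPow (1 / 2) (X ^ 2) * oneSubPow (1 / 2) (X ^ 2 + X ^ 3) := by
  have hhalf : (1 : ℝ) - 1 / 2 = 1 / 2 := by norm_num
  have h12 : insert 2 ({1} : Finset ℕ) = {1, 2} := by decide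
  have h2 : insert 2 (∅ : Finset ℕ) = {2} := by decide
  simp only [elim, half, hhalf, h12, h2, exF_empty, exF_one, exF_two, exF_pair,
    oneSubPow_zero_right, one_mul]
  ring

/-- **Sahi 2008, Example 13: the coefficient of `t⁵` in `F₂({1}) − F₂(∅)` is `−1/4`**
("`(1 − (1−t²)^{1/2})(1−t²−t³)^{1/2} ∼ (½t²)(−½t³) = −¼t⁵`"). [cite: Sahi2008, Example 13 (p. 222)] -/
theorem coeff_five_elim : coeff 5 (elim half 2 exF {1} - elim half 2 exF ∅) = -1 / 4 := by
  rw [elim_one_sub_elim_empty]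
  set S := oneSubPow (1 / 2) ((X : ℝ⟦X⟧) ^ 2 + X ^ 3) with hSdef
  set R := oneSubPow (1 / 2) ((X : ℝ⟦X⟧) ^ 2) with hRdef
  have hGS : constantCoeff ((X : ℝ⟦X⟧) ^ 2 + X ^ 3) = 0 := by simp
  have hGR : constantCoeff ((X : ℝ⟦X⟧) ^ 2) = 0 := by simp
  have hS0 : constantCoeff S = 1 := constantCoeff_oneSubPow hGS _
  have hR0 : constantCoeff R = 1 := constantCoeff_oneSubPow hGR _
  obtain ⟨s1, s2, s3, s4, s5⟩ := coeffs_sqrt_cubic S hS0 (oneSubPow_half_mul_self hGS)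
  obtain ⟨r1, r2, r3, r4, r5⟩ := coeffs_sqrt_quad R hR0 (oneSubPow_half_mul_self hGR)
  rw [map_sub, coeff_mul_range]
  simp only [Finset.sum_range_succ, Finset.sum_range_zero]
  norm_num
  rw [hR0, hS0, s1, s2, s3, s4, s5, r1, r2, r3, r4, r5]
  norm_num

/-- **"The negative sign shows that `F₂ ∉ ℐ[{1}]`."** [cite: Sahi2008, Example 13 (p. 222)] -/
theorem elim_not_inI : ¬ InI ({1} : Finset ℕ) (elim half 2 exF) := by
  rintro ⟨-, hdiff⟩
  have h := (hdiff ∅ {1} (Finset.empty_subset _) subset_rfl).2 5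
  rw [coeff_five_elim] at h
  norm_num at h

/-- **The printed obstruction, packaged** [cite: Sahi2008, §3.3 (p. 221) and p. 212]: the
implication "`F ∈ ℐ[X] ⇒ F_x ∈ ℐ[X ∖ {x}]`", which would carry the inductive proof of Theorem 1
from `𝒞` over to `ℐ` (the "slight natural strengthening" of Conjecture 4), is FALSE — already for
`X = {1,2}`, `x = 2`, parameters `m ≡ 1/2 ∈ [0,1]` and the `F` of Example 13. -/
theorem elimination_not_increasing :
    ∃ (U : Finset ℕ) (x : ℕ) (m : ℕ → ℝ) (F : Finset ℕ → ℝ⟦X⟧),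
      (∀ y, 0 ≤ m y ∧ m y ≤ 1) ∧ x ∈ U ∧ InI U F ∧ ¬ InI (U.erase x) (elim m x F) := by
  refine ⟨{1, 2}, 2, half, exF, fun _ => ⟨by norm_num [half], by norm_num [half]⟩, by simp,
    exF_inI, ?_⟩
  have h : ({1, 2} : Finset ℕ).erase 2 = {1} := by decide
  rw [h]
  exact elim_not_inI

end Literature.Barriers.CriticalPhenomena.SahiElimination

end
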